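import Mathlib

/-!
# Venture HSemireg — THEOREM N″ at the (S4) rung `n = 6` (and every `n ≥ 3`), I: THE KOSZUL DEGREE LEDGER
# (where `n` enters th-5's four steps) and Step 1's Atiyah-class algebra

HONEST FRAMING.  Part of the Lean side of the computation cell `pub-hsemireg` (track «S4-PUSH» (ii), lane pen s4-prove-1,
note `run/shared/lean/pub/pub-hsemireg/s4push/prove-1/ATTEMPT-5.md` §2–§3; routed residual (R-i) of corner 1: «extend
th-5's THEOREM N″ — theory/TH5-PORTEOUS-LEMMA-N.md §5, the mechanism of the cell's signed NEGATIVE #12 at `g = 6` — to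
the rung `n = 6`»).  MODEL-LEVEL, like the `ObstructionLocus*` files: closed-form bookkeeping, arbitrary carriers.
Nothing here constructs an abelian variety, a degeneracy locus or a cohomology group; nothing here says that HC / HC_CM /
HC_AV holds; no Literature fact is declared or used; NEGATIVE #12's signed text does not move.

SETTING (ATTEMPT-5 §0; th-5 §5 with `3 ↦ n`).  `A` an abelian `2n`-fold, `E = ⊕_{a ≤ e} N_a`, `F = ⊕_{i ≤ f} M_i`,
`f = e + n − 1`, (H1) every `M_i ⊗ N_a⁻¹` ample, `φ : E → F` generic, `Z = D_{e−1}(φ)` a smooth `n`-fold; `P = ℙ(E) → A`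
(fibre `ℙ^{e−1}`, `dim P = 2n + e − 1`), `V = π*F ⊗ 𝒪_P(1)` (rank `f`), `Z̃ = Z(s) ≅ Z` a regular zero scheme, Koszul
resolution `∧^•V^∨ → 𝒪_Z̃`.  For `T` locally free on `P` the spectral sequence `E₁^{−j,k} = H^k(P, ∧ʲV^∨ ⊗ T) ⟹
H^{k−j}(Z̃, T|)` has edge map = restriction `H^q(P,T) → H^q(Z̃,T|)`, INJECTIVE if `E₁^{−r,q+r−1} = 0 ∀ r ≥ 1` and
SURJECTIVE if `E₁^{−j,q+j} = 0 ∀ j ≥ 1`.  Bott's formula (`R^bπ_*𝒪_P(s)`: `Symˢ E^∨` for `b = 0, s ≥ 0`; monomials `N^β`,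
`|β| = −s`, for `b = e − 1`, `s ≤ −e`; else `0`) and Mumford's index theorem under (H1) (a product of `j ≥ 1` line bundles
`M_i⁻¹N_a` has cohomology in degree `2n` only; `M_iN_a⁻¹` in degree `0` only) confine the terms with `j ≥ 1` to the
POSSIBLE SUPPORTS `SuppO` (`T = 𝒪_P`), `SuppO1` (`T = π*N_c(1)`), `SuppRel` (`T = T_{P/A}`, Euler sandwich) below —
that translation is PAPER (ATTEMPT-5 §2); what is kernel-checked is the arithmetic of the supports, i.e. exactly which
`(n, q)` make the injectivity / surjectivity criteria hold.

PROVED HERE (kernel): `twistSupp_zero_iff` / `twistSupp_one_iff` (rows (a0)/(a1) DERIVED from Bott's rule `BottDeg` + the index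
degree `2n`), `injDeg_O` (INJ_q(𝒪) for `q ≤ n`), `surjDeg_O` (SURJ_q(𝒪) for `q + 1 ≤ n`), `suppO_totalDegree`
(total degrees `[n, 2n−1]`), `suppRel_totalDegree` (`[n−1, 2n−1]`), **`injDeg_rel`** (INJ_q(T_{P/A}) for `q + 1 ≤ n`: at
`q = 2` = Step 1's `H²(P,T_{P/A}) ↪ H²(Z̃, T_{P/A}|)`, needs `n ≥ 3` — THE BINDING ROW), `surjDeg_rel` (Step 3),
`suppRel_two` (SHARPNESS: at `n = 2` the criterion fails at `j = f` — th-5's «`n = 2` not claimed»), `not_suppRel_diag`,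
`ledger_rung_six` (every input of Steps 1–4 at `n = 6`, `f = e + 5`); and Step 1's algebra `diagonal_isScalar_iff`
(for split `E`, `ξ ∪ At(E) = diag(ξ⌟l_a)` is a scalar class iff all `ξ⌟l_a` agree).  File II
(`PorteousConfinement.lean`) carries the pair space, the class read-out and the NEG-#12-shaped assembly.
References (dictionary only): TH5-PORTEOUS-LEMMA-N.md b33026951e7dfe7a §5 + (h6); ATTEMPT-5.md §2; Mumford, Abelian
Varieties §16; Bott's formula for projective bundles (Hartshorne III Ex. 8.4).
-/

open scoped BigOperators
open Finset

namespace Summit.Ventures.HSemireg.PorteousConfinement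

/-! ## §1 The Koszul degree ledger (ATTEMPT-5 §2): where `n` enters -/

/-- Row (a0), `T = 𝒪_P`: the possible support of `E₁^{−j,k} = H^k(P, ∧ʲV^∨)` for `j ≥ 1` — Bott (`R^bπ_*𝒪_P(−j) ≠ 0` only
for `j ≥ e`, `b = e − 1`, a sum of monomials `N^β`, `|β| = j`) and the index theorem under (H1) (`M_I⁻¹N^β` is a product of
`j` anti-ample line bundles: cohomology in degree `2n` only): `e ≤ j ≤ f = e + n − 1` and `k = 2n + e − 1`. -/
def SuppO (n e j k : ℕ) : Prop := e ≤ j ∧ j ≤ e + n - 1 ∧ k = 2 * n + e - 1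

/-- Row (a1), `T = π*N_c ⊗ 𝒪_P(1)`: for `j ≥ 1` the term `H^k(P, ∧ʲV^∨ ⊗ π*N_c(1))` can be non-zero only at `(j,k) = (1, 2n)`
(`𝒪_P(0)`-part: `H^{2n}(A, N_cM_i⁻¹)`) or at `e + 1 ≤ j ≤ f`, `k = 2n + e − 1` (`b = e − 1`: `N_cM_I⁻¹N^β`, `|β| = j − 1`). -/
def SuppO1 (n e j k : ℕ) : Prop := (j = 1 ∧ k = 2 * n) ∨ (e + 1 ≤ j ∧ j ≤ e + n - 1 ∧ k = 2 * n + e - 1)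

/-- Row (b), `T = T_{P/A}` (the Euler sandwich `H^k(∧ʲV^∨ ⊗ π*E(1)) → E₁^{−j,k}(T_{P/A}) → H^{k+1}(∧ʲV^∨)`): the term can be
non-zero only if the left term is in row (a1) (summed over the letters `N_b` of `E`) or the right term, ONE DEGREE UP, is in
row (a0). -/
def SuppRel (n e j k : ℕ) : Prop := SuppO1 n e j k ∨ SuppO n e j (k + 1)

/-- BOTT'S RULE for `π : P = ℙ(E) → A`, fibre `ℙ^{e−1}`: `R^bπ_*𝒪_P(s) ≠ 0` only for (`s ≥ 0`, `b = 0`: `Symˢ E^∨`) or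
(`s ≤ −e`, `b = e − 1`: the monomials `N^β`, `|β| = −s`); nothing for `−e < s < 0` (Hartshorne III Ex. 8.4). -/
def BottDeg (e : ℕ) (s : ℤ) (b : ℕ) : Prop := (0 ≤ s ∧ b = 0) ∨ (s ≤ -(e : ℤ) ∧ b = e - 1)

/-- The support of `E₁^{−j,k}(π*G ⊗ 𝒪_P(t))`, `1 ≤ j ≤ f`, DERIVED from Bott's rule (fibre degree `b` at `s = t − j`) and
the index theorem under (H1) (`A`-degree `2n`: for `t ∈ {0, 1}` the `A`-line bundle of every summand is a product of `j`
anti-ample `M_i⁻¹N_a` — ATTEMPT-5 §2 rows (a0)/(a1); for other `t` the pairing fails and this def is NOT claimed). -/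
def TwistSupp (n e : ℕ) (t : ℤ) (j k : ℕ) : Prop :=
  1 ≤ j ∧ j ≤ e + n - 1 ∧ ∃ b : ℕ, BottDeg e (t - (j : ℤ)) b ∧ k = 2 * n + b

/-- Row (a0) is Bott + index at `t = 0`. -/
theorem twistSupp_zero_iff {n e j k : ℕ} (he : 1 ≤ e) : TwistSupp n e 0 j k ↔ 1 ≤ j ∧ SuppO n e j k := by
  unfold TwistSupp BottDeg SuppO
  constructor
  · rintro ⟨hj, hjf, b, hb, hk⟩; omega
  · rintro ⟨hj, hej, hjf, hk⟩; exact ⟨hj, hjf, e - 1, by omega, by omega⟩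

/-- Row (a1) is Bott + index at `t = 1`. -/
theorem twistSupp_one_iff {n e j k : ℕ} (he : 1 ≤ e) (hn : 1 ≤ n) : TwistSupp n e 1 j k ↔ 1 ≤ j ∧ SuppO1 n e j k := by
  unfold TwistSupp BottDeg SuppO1
  constructor
  · rintro ⟨hj, hjf, b, hb, hk⟩; omega
  · rintro ⟨hj, ⟨hj1, hk⟩ | ⟨hej, hjf, hk⟩⟩
    · exact ⟨hj, by omega, 0, by omega, by omega⟩
    · exact ⟨hj, hjf, e - 1, by omega, by omega⟩

/-- Row (a0): every term with `j ≥ 1` lives in total degree `k − j ∈ [n, 2n − 1]` («Koszul columns live in total degrees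
`≥ dim Z = n`», th-5 (h6)). -/
theorem suppO_totalDegree {n e j k : ℕ} (he : 1 ≤ e) (h : SuppO n e j k) : n ≤ k - j ∧ k - j ≤ 2 * n - 1 := by
  unfold SuppO at h; omega

/-- INJ_q(𝒪): for `q ≤ n` no term `E₁^{−r, q+r−1}`, `r ≥ 1`, is in the support, so `H^q(A, 𝒪) = H^q(P, 𝒪_P) → H^q(Z, 𝒪_Z)`
is injective; `q = 2` (Step 4: `H^{0,2}(A) ↪ H²(𝒪_Z)`) needs `n ≥ 2`. -/
theorem injDeg_O {n e q : ℕ} (he : 1 ≤ e) (hq : q ≤ n) : ∀ r, 1 ≤ r → ¬ SuppO n e r (q + r - 1) := by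
  intro r hr h; unfold SuppO at h; omega

/-- SURJ_q(𝒪): for `q + 1 ≤ n` no term `E₁^{−j, q+j}`, `j ≥ 1`, is in the support, so `H^q(A, 𝒪) → H^q(Z, 𝒪_Z)` is onto
(`q = 1`, with INJ₂(𝒪): `H²(A, I_Z) = 0`, «every abstract first-order deformation of `Z` is a pair deformation»). -/
theorem surjDeg_O {n e q : ℕ} (he : 1 ≤ e) (hq : q + 1 ≤ n) : ∀ j, 1 ≤ j → ¬ SuppO n e j (q + j) := by
  intro j hj h; unfold SuppO at h; omega

/-- Row (b): the possible support of `E₁(T_{P/A})` lies in total degrees `{2n−1} ∪ [n, 2n−2] ∪ [n−1, 2n−2]` — the last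
family (right term of the sandwich, one degree up) reaches `n − 1` at `j = f`. -/
theorem suppRel_totalDegree {n e j k : ℕ} (he : 1 ≤ e) (hn : 1 ≤ n) (h : SuppRel n e j k) :
    n - 1 ≤ k - j ∧ k - j ≤ 2 * n - 1 := by
  unfold SuppRel SuppO1 SuppO at h; omega

/-- **THE BINDING ROW.**  INJ_q(T_{P/A}) for `q + 1 ≤ n`: no `E₁^{−r, q+r−1}(T_{P/A})`, `r ≥ 1`, is in the possible support.
At `q = 2` this is Step 1's injectivity `H²(P, T_{P/A}) ↪ H²(Z̃, T_{P/A}|_Z̃)` and needs exactly `n ≥ 3` (the three families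
would need `r = 1 = 2n − 1`, `r = 2n + e − 2 ≤ f`, `r = 2n + e − 3 ≤ f`, i.e. `n ≤ 1`, `n ≤ 1`, `n ≤ 2`). -/
theorem injDeg_rel {n e q : ℕ} (he : 1 ≤ e) (hq : q + 1 ≤ n) : ∀ r, 1 ≤ r → ¬ SuppRel n e r (q + r - 1) := by
  intro r hr h; unfold SuppRel SuppO1 SuppO at h; omega

/-- SURJ_q(T_{P/A}) for `q + 2 ≤ n` (the same condition as INJ_{q+1}): at `q = 1`, `H¹(P, T_{P/A}) → H¹(Z̃, T_{P/A}|)` is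
onto (Step 3), again exactly `n ≥ 3`. -/
theorem surjDeg_rel {n e q : ℕ} (he : 1 ≤ e) (hq : q + 2 ≤ n) : ∀ j, 1 ≤ j → ¬ SuppRel n e j (q + j) := by
  intro j hj h; unfold SuppRel SuppO1 SuppO at h; omega

/-- **Sharpness of the criterion** (th-5: «`n = 2` not claimed»; (h6) toy): at `n = 2` (`f = e + 1`, `Z` a surface in a
fourfold) the right term of the sandwich at `j = f`, `H^{f+2}(P, ∧ᶠV^∨) = H^{2n}(A, det F⁻¹ ⊗ E ⊗ det E) ≠ 0`, IS in the
support of `E₁^{−f, f+1}(T_{P/A})`, so INJ₂(T_{P/A}) is not given by the ledger. -/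
theorem suppRel_two (e : ℕ) (he : 1 ≤ e) : SuppRel 2 e (e + 1) (e + 1 + 1) := by
  unfold SuppRel SuppO; right; omega

/-- Conversely for `n ≥ 3` the diagonal `(r, r+1)` misses the possible support for every `r ≥ 1` (`= injDeg_rel` at
`q = 2`, displayed). -/
theorem not_suppRel_diag {n e : ℕ} (hn : 3 ≤ n) (he : 1 ≤ e) (r : ℕ) (hr : 1 ≤ r) : ¬ SuppRel n e r (r + 1) := by
  have h := injDeg_rel (n := n) (e := e) (q := 2) he (by omega) r hr
  simpa [show 2 + r - 1 = r + 1 by omega] using h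

/-- **The ledger at the rung `n = 6`** (Weil-type 12-folds, `f = e + 5`, `dim P = e + 11`): all five cohomological inputs of
THEOREM N″ hold with margin — INJ₂ and SURJ₁ for `T_{P/A}` (Steps 1, 3), INJ₂ and SURJ₁ for `𝒪` (Step 4 and the
pair-deformation remark); in fact INJ_q(T_{P/A}) for all `q ≤ 5` and INJ_q(𝒪) for all `q ≤ 6`. -/
theorem ledger_rung_six (e : ℕ) (he : 1 ≤ e) :
    (∀ r, 1 ≤ r → ¬ SuppRel 6 e r (2 + r - 1)) ∧ (∀ j, 1 ≤ j → ¬ SuppRel 6 e j (1 + j)) ∧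
    (∀ r, 1 ≤ r → ¬ SuppO 6 e r (2 + r - 1)) ∧ (∀ j, 1 ≤ j → ¬ SuppO 6 e j (1 + j)) ∧
    (∀ q, q ≤ 5 → ∀ r, 1 ≤ r → ¬ SuppRel 6 e r (q + r - 1)) ∧ (∀ q, q ≤ 6 → ∀ r, 1 ≤ r → ¬ SuppO 6 e r (q + r - 1)) :=
  ⟨injDeg_rel he (by norm_num), surjDeg_rel he (by norm_num), injDeg_O he (by norm_num), surjDeg_O he (by norm_num),
    fun q hq => injDeg_rel he (by omega), fun q hq => injDeg_O he (by omega)⟩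

/-! ## §2 Step 1: the Atiyah class of a split bundle modulo scalars -/

section StepOne

variable {H : Type*} [AddCommGroup H] {e : ℕ}

/-- A class in `H²(A, End E) = ⊕_{a,b} H²(A, N_aN_b⁻¹)` (split `E = ⊕_{a ≤ e} N_a`; coefficients in `H = H^{0,2}(A)` on
the diagonal) is SCALAR if it lies in `H^{0,2}(A)·id` — the classes killed by `H²(End E) → H²(End E / 𝒪) = H²(P, T_{P/A})`
(trace splitting in characteristic `0`: nothing else is killed). -/
def IsScalarClass (M : Matrix (Fin e) (Fin e) H) : Prop := ∃ c : H, M = Matrix.diagonal fun _ => c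

/-- For split `E`, `At(E) = diag(c₁(N_a))`, so `∂ξ = [ξ ∪ At(E)] = [diag(ξ⌟l_a)]` (th-5 Step 1, (G3)–(G4)): it is scalar —
i.e. `∂ξ = 0` in `H²(P, T_{P/A})` — iff ALL the contractions `ξ⌟l_a` are equal.  With INJ₂(T_{P/A}) (`injDeg_rel`, `n ≥ 3`):
`ob_{Z/A}(ξ) = 0 ⇒ (∂ξ)|_Z̃ = 0 ⇒ ∂ξ = 0 ⇒ ξ⌟(l_a − l_b) = 0` for all `a, b`. -/
theorem diagonal_isScalar_iff (x : Fin e → H) :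
    IsScalarClass (Matrix.diagonal x) ↔ ∀ a b : Fin e, x a = x b := by
  constructor
  · rintro ⟨c, hc⟩ a b
    have h := Matrix.diagonal_eq_diagonal_iff.1 hc
    rw [h a, h b]
  · intro h
    rcases Nat.eq_zero_or_pos e with he | he
    · subst he
      exact ⟨0, Matrix.diagonal_eq_diagonal_iff.2 fun a => a.elim0⟩
    · exact ⟨x ⟨0, he⟩, Matrix.diagonal_eq_diagonal_iff.2 fun a => h a _⟩

end StepOne

end Summit.Ventures.HSemireg.PorteousConfinement
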